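import Summits.KontsevichZagierPeriods.KontsevichZagierPeriods.Theorems.SoloBlindFermatCubic
import Summits.KontsevichZagierPeriods.KontsevichZagierPeriods.Theorems.SoloBlindBoxRankOne
import HarnessLib

/-!
# Circular segments cut by rational chords lie in the cell span

For a rational `0 ≤ a < 1` let `C_a` be the part of the unit disc beyond the chord `u = a`
(`a < u < 1`, `v ≥ 0`), written over the unit interval by `u = a + (1-a)x`:

  `C_a = {(x,y) | 0 < x < 1, 0 ≤ y, (a + (1-a)x)² + y² ≤ 1}`   (`ℚ`-rational, integrand `1`),

of area `(arccos a - a√(1-a²)) / (2(1-a))` — for rational `a ≠ 0` NOT an algebraic multiple of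
`π` in general.  Three moves inside the Kontsevich–Zagier rules place it in the cell span
`V = K₀·1 ⊕ ⨁ K₀·ℓ(μ) ⊕ ⨁ K₀·a(t)`: Newton–Leibniz to `[(0,1), √(1-(a+(1-a)x)²) dx]`, then the
RATIONAL PARAMETRISATION OF THE CIRCLE `u = (1-t²)/(1+t²)` (the half-angle chart), which turns the
integrand into the `ℚ`-rational function `8t²/((1-a)(1+t²)³)` on `(0, τ_a)`,
`τ_a = √((1-a)/(1+a)) = tan(½ arccos a)`.  Hence `[C_a] ∈ V` (`mkQ_seg2_mem_cellSpan`),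
`area(C_a) = (arctan τ_a - a(1+a)τ_a/2)/(1-a)` read off from the moves (companion file
`SoloBlindCircleSegmentArea`), and
**the Kontsevich–Zagier conjecture holds for `C_a`** against every representation with class in
`V` — log cells, arctangent cells, triangles, discs, other segments (`kz_seg2`, `kz_seg2_seg2`;
Baker).  This is the circle case of the genus-zero principle behind `SoloBlindSilver`.

References: Kontsevich–Zagier, *Periods* (2001), §1.1–1.2. -/

noncomputable section

namespace Summit.KontsevichZagierPeriods.KontsevichZagierPeriods.Theorems

open Set MeasureTheory
open Literature.ModelTheory.ExponentialFields (IsSemialgebraic)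
open MvPolynomial (aeval X C)
open Literature.NumberTheory.Transcendental
open Literature.NumberTheory.Transcendental.KZ

namespace SoloBlind

variable (a : ℚ)

/-- The chord coordinate `u = a + (1-a)x`. -/
def segU (x : ℝ) : ℝ := (a : ℝ) + (1 - a) * x

/-- `s(x) = (1 - u²)^{1/2}`, `u = a + (1-a)x`. -/
def segF (x : ℝ) : ℝ := (1 - segU a x ^ 2) ^ ((((1:ℚ) / 2 : ℚ)) : ℝ)

/-- `s(x) = √(1-u²)`. -/
theorem segF_eq (x : ℝ) : segF a x = Real.sqrt (1 - segU a x ^ 2) := by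
  rw [segF, Real.sqrt_eq_rpow]
  norm_num

/-- `0 ≤ s(x)`. -/
theorem segF_nonneg (x : ℝ) : 0 ≤ segF a x := by rw [segF_eq]; exact Real.sqrt_nonneg _

variable {a}

/-- `a < u < 1` on `(0,1)`, hence `0 < 1 - u²`, for `0 ≤ a < 1`. -/
theorem one_sub_segU_sq_pos (ha0 : 0 ≤ a) (ha1 : a < 1) {x : ℝ} (hx : x ∈ Ioo (0:ℝ) 1) :
    0 < 1 - segU a x ^ 2 := by
  have ha0' : (0:ℝ) ≤ a := by exact_mod_cast ha0
  have ha1' : (a:ℝ) < 1 := by exact_mod_cast ha1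
  have hu0 : 0 < segU a x := by unfold segU; nlinarith [hx.1, hx.2]
  have hu1 : segU a x < 1 := by unfold segU; nlinarith [hx.1, hx.2]
  nlinarith

variable (a)

/-- `s` is continuous. -/
theorem continuous_segF : Continuous (segF a) :=
  (continuous_const.sub ((continuous_const.add (continuous_const.mul continuous_id)).pow 2))
    |>.rpow_const fun _ => Or.inr (by norm_num)

/-- `s` is integrable on `(0,1)`. -/
theorem integrableOn_segF : IntegrableOn (segF a) (Ioo 0 1) :=
  ((continuous_segF a).continuousOn.integrableOn_Icc (μ := volume)).mono_set Ioo_subset_Icc_self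

/-- `s` is `ℚ`-semialgebraic on `(0,1)` for `0 ≤ a < 1` (an Euler–Mellin integrand). -/
theorem isSemialgebraicFunOn_segF (ha0 : 0 ≤ a) (ha1 : a < 1) :
    IsSemialgebraicFunOn ℚ (line (Ioo 0 1)) (fun x : Fin 1 → ℝ => segF a (x 0)) := by
  have h := isSemialgebraicFunOn_mellinIntegrand
    (isSemialgebraic_line_Ioo isAlgebraic_zero isAlgebraic_one)
    ![(1 - (C a + C (1 - a) * X 0) ^ 2 : MvPolynomial (Fin 1) ℚ)] ![((1:ℚ) / 2 : ℚ)] 1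
    (fun x hx j => by
      have hx' : x 0 ∈ Ioo (0:ℝ) 1 := mem_line.mp hx
      have hp := one_sub_segU_sq_pos ha0 ha1 hx'
      simp only [segU] at hp
      simpa using hp)
  refine h.congr fun x _ => ?_
  simp only [mellinIntegrand_apply, Fin.prod_univ_one, Matrix.cons_val_fin_one, map_sub, map_one,
    map_pow, map_add, map_mul, MvPolynomial.aeval_X, MvPolynomial.aeval_C, eq_ratCast, segF, segU]
  push_cast
  ring_nf

/-- **`S₁ = [(0,1), √(1-(a+(1-a)x)²) dx]`.** -/
def seg1 (ha0 : 0 ≤ a) (ha1 : a < 1) : IntegralRep 1 :=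
  lineRep (Ioo 0 1) (segF a) (isSemialgebraic_line_Ioo isAlgebraic_zero isAlgebraic_one)
    (isSemialgebraicFunOn_segF a ha0 ha1) (integrableOn_segF a)

/-! ## The segment `C_a` -/

/-- `C_a = {0 < x < 1, 0 ≤ y, y² ≤ 1 - (a+(1-a)x)²}`. -/
def kzSeg : Set (Fin 2 → ℝ) :=
  {z | (0 < z 0 ∧ z 0 < 1) ∧ 0 ≤ z 1 ∧ z 1 ^ 2 ≤ 1 - ((a : ℝ) + (1 - a) * z 0) ^ 2}

/-- `C_a` is `ℚ`-semialgebraic. -/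
theorem isSemialgebraic_kzSeg : IsSemialgebraic ℚ (kzSeg a) := by
  convert isSemialgebraic_subgraph (X 1 ^ 2) (1 - (C a + C (1 - a) * X 0) ^ 2) using 1
  ext z
  simp [kzSeg]

/-- `C_a` is the region under the graph of `s`. -/
theorem kzSeg_eq (ha0 : 0 ≤ a) (ha1 : a < 1) :
    kzSeg a = {z | (0 < z 0 ∧ z 0 < 1) ∧ 0 ≤ z 1 ∧ z 1 ≤ segF a (z 0)} := by
  ext z
  simp only [kzSeg, mem_setOf_eq]
  refine and_congr_right fun hx => and_congr_right fun hy => ?_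
  rw [segF_eq, Real.le_sqrt hy, segU]
  exact (one_sub_segU_sq_pos ha0 ha1 hx).le

/-- `C_a` lies in the unit square. -/
theorem kzSeg_subset : kzSeg a ⊆ Icc 0 1 := subset_Icc_of_le_one fun z hz => by
  obtain ⟨hx, hy, h⟩ := hz
  refine ⟨hx, hy, ?_⟩
  have h1 : z 1 ^ 2 ≤ 1 := h.trans (sub_le_self _ (sq_nonneg _))
  exact (sq_le_one_iff₀ hy).mp h1

/-- **`C_a = [{0<x<1, 0≤y, (a+(1-a)x)²+y²≤1}, 1]`**, with `ℚ`-rational data. -/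
def seg2 : IntegralRep 2 :=
  ratRep (kzSeg a) (fun _ => 1) 1 1 (isSemialgebraic_kzSeg a) (fun _ _ => by simp)
    (fun _ _ => by simp) (integrableOn_one_of_subset_Icc (kzSeg_subset a))

/-- `C_a` has KZ's literal rational shape. -/
theorem isRational_seg2 : (seg2 a).IsRational := isRational_ratRep

/-- **Move (Newton–Leibniz): `C_a ≡ S₁`.** -/
theorem seg2_sub_seg1 (ha0 : 0 ≤ a) (ha1 : a < 1) :
    of (seg2 a) - of (seg1 a ha0 ha1) ∈ relations :=
  subgraph_sub_lineRep (seg2 a) (fun x _ => segF_nonneg a x) (kzSeg_eq a ha0 ha1) rfl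

/-! ## The half-angle chart `u = (1-t²)/(1+t²)` -/

/-- `τ_a = √((1-a)/(1+a)) = tan(½ arccos a)`. -/
def tau : ℝ := Real.sqrt ((1 - a) / (1 + a))

/-- `τ_a² = (1-a)/(1+a)`. -/
theorem tau_sq (ha0 : 0 ≤ a) (ha1 : a < 1) : tau a ^ 2 = (1 - a) / (1 + a) := by
  have ha0' : (0:ℝ) ≤ a := by exact_mod_cast ha0
  have ha1' : (a:ℝ) < 1 := by exact_mod_cast ha1
  exact Real.sq_sqrt (div_pos (by linarith) (by linarith)).le

/-- `0 < τ_a`. -/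
theorem tau_pos (ha0 : 0 ≤ a) (ha1 : a < 1) : 0 < tau a := by
  have ha0' : (0:ℝ) ≤ a := by exact_mod_cast ha0
  have ha1' : (a:ℝ) < 1 := by exact_mod_cast ha1
  exact Real.sqrt_pos.mpr (div_pos (by linarith) (by linarith))

/-- `τ_a` is algebraic (a root of `X² - (1-a)/(1+a)`). -/
theorem isAlgebraic_tau (ha0 : 0 ≤ a) (ha1 : a < 1) : IsAlgebraic ℚ (tau a) := by
  have h : IsAlgebraic ℚ ((((1 - a) / (1 + a) : ℚ)) : ℝ) := isAlgebraic_algebraMap _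
  have h' : ((((1 - a) / (1 + a) : ℚ)) : ℝ) = tau a ^ 2 := by rw [tau_sq a ha0 ha1]; push_cast; rfl
  rw [h'] at h
  exact IsAlgebraic.of_pow two_pos h

/-- The chart `φ(t) = ((1-t²)/(1+t²) - a)/(1-a)`. -/
def circChart (t : ℝ) : ℝ := ((1 - t ^ 2) / (1 + t ^ 2) - a) / (1 - a)

/-- Its derivative `φ'(t) = -4t/((1-a)(1+t²)²)`, in quotient-rule form. -/
def circChart' (t : ℝ) : ℝ :=
  ((-(2 * t) * (1 + t ^ 2) - (1 - t ^ 2) * (2 * t)) / (1 + t ^ 2) ^ 2) / (1 - a)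

/-- `|φ'(t)| = 4t/((1-a)(1+t²)²)` for `t ≥ 0`, `a < 1`. -/
theorem abs_circChart' (ha1 : a < 1) {t : ℝ} (ht : 0 ≤ t) :
    |circChart' a t| = 4 * t / ((1 - a) * (1 + t ^ 2) ^ 2) := by
  have ha1' : (a:ℝ) < 1 := by exact_mod_cast ha1
  have h1 : (0:ℝ) < 1 - a := by linarith
  have h0 : 0 ≤ 4 * t / ((1 + t ^ 2) ^ 2) / (1 - a) := div_nonneg (by positivity) h1.le
  rw [circChart', show (-(2 * t) * (1 + t ^ 2) - (1 - t ^ 2) * (2 * t)) = -(4 * t) by ring,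
    neg_div, neg_div, abs_neg, abs_of_nonneg h0, div_div, mul_comm ((1 + t ^ 2) ^ 2) (1 - (a:ℝ))]

/-- `u ∘ φ = (1-t²)/(1+t²)`: the chart lands on the circle parametrisation. -/
theorem segU_circChart (ha1 : a < 1) (t : ℝ) :
    segU a (circChart a t) = (1 - t ^ 2) / (1 + t ^ 2) := by
  have ha1' : (a:ℝ) < 1 := by exact_mod_cast ha1
  have h1 : (1:ℝ) - a ≠ 0 := by linarith
  unfold segU circChart
  field_simp
  ring

/-- The quotient rule for `φ`. -/
theorem hasDerivAt_circChart (t : ℝ) : HasDerivAt (circChart a) (circChart' a t) t := by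
  have h1 : HasDerivAt (fun y : ℝ => 1 - y ^ 2) (-(2 * t)) t := by
    simpa using (hasDerivAt_pow 2 t).const_sub 1
  have h2 : HasDerivAt (fun y : ℝ => 1 + y ^ 2) (2 * t) t := by
    simpa using (hasDerivAt_pow 2 t).const_add 1
  have h := ((h1.div h2 (by positivity)).sub_const (a:ℝ)).div_const ((1:ℝ) - a)
  exact h

/-- `φ` is `ℚ`-semialgebraic on `(0, τ_a)` (a rational function over `ℚ`). -/
theorem isSemialgebraicFunOn_circChart (ha0 : 0 ≤ a) (ha1 : a < 1) :
    IsSemialgebraicFunOn ℚ (line (Ioo 0 (tau a))) (fun x : Fin 1 → ℝ => circChart a (x 0)) := by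
  have ha1' : (a:ℝ) < 1 := by exact_mod_cast ha1
  have hS := isSemialgebraic_line_Ioo isAlgebraic_zero (isAlgebraic_tau a ha0 ha1)
  refine (isSemialgebraicFunOn_aeval_div_aeval hS ((1 - X 0 ^ 2) - C a * (1 + X 0 ^ 2))
    (C (1 - a) * (1 + X 0 ^ 2)) fun x _ => ?_).congr fun x _ => ?_
  · have h : aeval x (C (1 - a) * (1 + X 0 ^ 2) : MvPolynomial (Fin 1) ℚ) =
        ((1 - a : ℚ) : ℝ) * (1 + x 0 ^ 2) := by simp
    rw [h]
    push_cast
    have : (0:ℝ) < 1 - a := by linarith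
    positivity
  · have h1 : (1:ℝ) - a ≠ 0 := by linarith
    simp only [map_sub, map_mul, map_add, map_one, map_pow, MvPolynomial.aeval_X,
      MvPolynomial.aeval_C, eq_ratCast, circChart]
    field_simp

/-- `φ` is strictly decreasing on `[0, ∞)`. -/
theorem strictAntiOn_circChart (ha1 : a < 1) : StrictAntiOn (circChart a) (Ici 0) := by
  have ha1' : (a:ℝ) < 1 := by exact_mod_cast ha1
  intro s hs t ht hst
  have hs0 : (0:ℝ) ≤ s := hs
  have h1 : (0:ℝ) < 1 - a := by linarith
  have hc : (1 - t ^ 2) / (1 + t ^ 2) < (1 - s ^ 2) / (1 + s ^ 2) := by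
    rw [div_lt_div_iff₀ (by positivity) (by positivity)]
    nlinarith [mul_pos (sub_pos.mpr hst) (add_pos_of_nonneg_of_pos hs0 (hs0.trans_lt hst))]
  unfold circChart
  exact div_lt_div_of_pos_right (sub_lt_sub_right hc _) h1

/-- `φ` is injective on `(0, τ_a)`. -/
theorem injOn_circChart (ha1 : a < 1) : InjOn (circChart a) (Ioo 0 (tau a)) :=
  (strictAntiOn_circChart a ha1).injOn.mono fun _ ht => mem_Ici.mpr ht.1.le

/-- `φ(0) = 1`. -/
theorem circChart_zero (ha1 : a < 1) : circChart a 0 = 1 := by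
  have ha1' : (a:ℝ) < 1 := by exact_mod_cast ha1
  have h1 : (1:ℝ) - a ≠ 0 := by linarith
  simp [circChart, h1]

/-- `φ(τ_a) = 0`. -/
theorem circChart_tau (ha0 : 0 ≤ a) (ha1 : a < 1) : circChart a (tau a) = 0 := by
  have ha0' : (0:ℝ) ≤ a := by exact_mod_cast ha0
  rw [circChart, tau_sq a ha0 ha1]
  have h2 : (1:ℝ) + a ≠ 0 := by linarith
  field_simp
  ring

/-- The inverse chart lands in `(0, τ_a)`. -/
theorem invCircChart_mem (ha0 : 0 ≤ a) (ha1 : a < 1) {x : ℝ} (hx : x ∈ Ioo (0:ℝ) 1) :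
    Real.sqrt ((1 - segU a x) / (1 + segU a x)) ∈ Ioo 0 (tau a) := by
  have ha0' : (0:ℝ) ≤ a := by exact_mod_cast ha0
  have ha1' : (a:ℝ) < 1 := by exact_mod_cast ha1
  have hu0 : (a:ℝ) < segU a x := by unfold segU; nlinarith [hx.1, hx.2]
  have hu1 : segU a x < 1 := by unfold segU; nlinarith [hx.1, hx.2]
  refine ⟨Real.sqrt_pos.mpr (div_pos (by linarith) (by linarith)), ?_⟩
  unfold tau
  refine Real.sqrt_lt_sqrt (div_pos (by linarith) (by linarith)).le ?_
  rw [div_lt_div_iff₀ (by linarith) (by linarith)]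
  nlinarith

/-- `φ` inverts the inverse chart. -/
theorem circChart_inv (ha0 : 0 ≤ a) (ha1 : a < 1) {x : ℝ} (hx : x ∈ Ioo (0:ℝ) 1) :
    circChart a (Real.sqrt ((1 - segU a x) / (1 + segU a x))) = x := by
  have ha0' : (0:ℝ) ≤ a := by exact_mod_cast ha0
  have ha1' : (a:ℝ) < 1 := by exact_mod_cast ha1
  have hu0 : (a:ℝ) < segU a x := by unfold segU; nlinarith [hx.1, hx.2]
  have hu1 : segU a x < 1 := by unfold segU; nlinarith [hx.1, hx.2]
  have h1 : (0:ℝ) < 1 + segU a x := by linarith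
  rw [circChart, Real.sq_sqrt (div_pos (by linarith) h1).le]
  have h2 : (1:ℝ) - a ≠ 0 := by linarith
  unfold segU at h1 ⊢
  field_simp
  ring

/-- `φ` maps `(0, τ_a)` onto `(0,1)`. -/
theorem image_circChart (ha0 : 0 ≤ a) (ha1 : a < 1) :
    Ioo (0:ℝ) 1 = circChart a '' Ioo 0 (tau a) := by
  ext x
  constructor
  · intro hx
    exact ⟨_, invCircChart_mem a ha0 ha1 hx, circChart_inv a ha0 ha1 hx⟩
  · rintro ⟨t, ht, rfl⟩
    have hm := strictAntiOn_circChart a ha1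
    have ht0 : t ∈ Ici (0:ℝ) := mem_Ici.mpr ht.1.le
    refine ⟨?_, ?_⟩
    · rw [← circChart_tau a ha0 ha1]
      exact hm ht0 (mem_Ici.mpr (tau_pos a ha0 ha1).le) ht.2
    · rw [← circChart_zero a ha1]
      exact hm (show (0:ℝ) ∈ Ici 0 from mem_Ici.mpr le_rfl) ht0 ht.1

/-! ## The rational representation `ρ_a = [(0, τ_a), 8t²/((1-a)(1+t²)³) dt]` -/

/-- `g(t) = 8t²/((1-a)(1+t²)³)`. -/
def circG (t : ℝ) : ℝ := 8 * t ^ 2 / ((1 - a) * (1 + t ^ 2) ^ 3)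

/-- `g` is continuous (for `a < 1`). -/
theorem continuous_circG (ha1 : a < 1) : Continuous (circG a) := by
  have ha1' : (a:ℝ) < 1 := by exact_mod_cast ha1
  exact (continuous_const.mul (continuous_pow 2)).div
    (continuous_const.mul ((continuous_const.add (continuous_pow 2)).pow 3)) fun t => by
      have : (0:ℝ) < 1 - a := by linarith
      positivity

/-- `g` is `ℚ`-semialgebraic on `(0, τ_a)`. -/
theorem isSemialgebraicFunOn_circG (ha0 : 0 ≤ a) (ha1 : a < 1) :
    IsSemialgebraicFunOn ℚ (line (Ioo 0 (tau a))) (fun x : Fin 1 → ℝ => circG a (x 0)) := by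
  have ha1' : (a:ℝ) < 1 := by exact_mod_cast ha1
  have hS := isSemialgebraic_line_Ioo isAlgebraic_zero (isAlgebraic_tau a ha0 ha1)
  refine (isSemialgebraicFunOn_aeval_div_aeval hS (8 * X 0 ^ 2) (C (1 - a) * (1 + X 0 ^ 2) ^ 3)
    fun x _ => ?_).congr fun x _ => ?_
  · have h : aeval x (C (1 - a) * (1 + X 0 ^ 2) ^ 3 : MvPolynomial (Fin 1) ℚ) =
        ((1 - a : ℚ) : ℝ) * (1 + x 0 ^ 2) ^ 3 := by simp
    rw [h]
    push_cast
    have : (0:ℝ) < 1 - a := by linarith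
    positivity
  · simp only [map_mul, map_pow, map_add, map_one, MvPolynomial.aeval_X, MvPolynomial.aeval_C,
      circG]
    push_cast
    norm_num

/-- **`ρ_a = [(0, τ_a), 8t²/((1-a)(1+t²)³) dt]`.** -/
def segRho (ha0 : 0 ≤ a) (ha1 : a < 1) : IntegralRep 1 :=
  lineRep (Ioo 0 (tau a)) (circG a) (isSemialgebraic_line_Ioo isAlgebraic_zero
    (isAlgebraic_tau a ha0 ha1)) (isSemialgebraicFunOn_circG a ha0 ha1)
    (((continuous_circG a ha1).continuousOn.integrableOn_Icc (μ := volume)).mono_set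
      Ioo_subset_Icc_self)

/-- **`ρ_a` has KZ's literal rational shape** (its endpoint `τ_a` is in general irrational). -/
theorem isRational_segRho (ha0 : 0 ≤ a) (ha1 : a < 1) : (segRho a ha0 ha1).IsRational := by
  have ha1' : (a:ℝ) < 1 := by exact_mod_cast ha1
  refine ⟨8 * X 0 ^ 2, C (1 - a) * (1 + X 0 ^ 2) ^ 3, fun x _ => ?_, fun x _ => ?_⟩
  · have h : aeval x (C (1 - a) * (1 + X 0 ^ 2) ^ 3 : MvPolynomial (Fin 1) ℚ) =
        ((1 - a : ℚ) : ℝ) * (1 + x 0 ^ 2) ^ 3 := by simp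
    rw [h]
    push_cast
    have : (0:ℝ) < 1 - a := by linarith
    positivity
  · show circG a (x 0) = _
    simp only [map_mul, map_pow, map_add, map_one, MvPolynomial.aeval_X, MvPolynomial.aeval_C,
      circG]
    push_cast
    norm_num

/-- Pull-back of `s` along the chart: `s(φ(t))·|φ'(t)| = g(t)` for `t > 0`. -/
theorem segF_pullback (ha1 : a < 1) {t : ℝ} (ht : 0 < t) :
    circG a t = segF a (circChart a t) * |circChart' a t| := by
  have hq : 1 - ((1 - t ^ 2) / (1 + t ^ 2)) ^ 2 = (2 * t / (1 + t ^ 2)) ^ 2 := by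
    field_simp
    ring
  rw [abs_circChart' a ha1 ht.le, segF_eq, segU_circChart a ha1, hq, Real.sqrt_sq (by positivity),
    circG]
  have ha1' : (a:ℝ) < 1 := by exact_mod_cast ha1
  have h1 : (1:ℝ) - a ≠ 0 := by linarith
  field_simp
  ring

/-- **Move (`u = (1-t²)/(1+t²)`): `ρ_a ≡ S₁`.** -/
theorem segRho_sub_seg1 (ha0 : 0 ≤ a) (ha1 : a < 1) :
    of (segRho a ha0 ha1) - of (seg1 a ha0 ha1) ∈ relations := by
  unfold segRho seg1
  exact lineRep_subst (circChart a) (circChart' a) (isSemialgebraicFunOn_circChart a ha0 ha1)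
    (fun t _ => (hasDerivAt_circChart a t).hasDerivWithinAt) (injOn_circChart a ha1)
    (image_circChart a ha0 ha1) (fun t ht => segF_pullback a ha1 ht.1)

/-! ## `[C_a] ∈ V` and the conjecture for `C_a` -/

/-- **`[C_a] = [ρ_a]`** in `Q`: two moves. -/
theorem mkQ_seg2 (ha0 : 0 ≤ a) (ha1 : a < 1) :
    mkQ (of (seg2 a)) = mkQ (of (segRho a ha0 ha1)) := by
  rw [mkQ_eq_mkQ_iff, ← sub_sub_sub_cancel_right _ _ (of (seg1 a ha0 ha1))]
  exact relations.sub_mem (seg2_sub_seg1 a ha0 ha1) (segRho_sub_seg1 a ha0 ha1)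

/-- **`C_a` lies in the cell span `V`.** -/
theorem mkQ_seg2_mem_cellSpan (ha0 : 0 ≤ a) (ha1 : a < 1) : mkQ (of (seg2 a)) ∈ cellSpan := by
  rw [mkQ_seg2 a ha0 ha1]
  exact mkQ_of_mem_cellSpan _ le_rfl (isRational_segRho a ha0 ha1)

/-- **The Kontsevich–Zagier conjecture for the circular segment `C_a`** against every
representation with class in `V` (Baker). -/
theorem kz_seg2 (ha0 : 0 ≤ a) (ha1 : a < 1) {d : ℕ} (r' : IntegralRep d)
    (hr' : mkQ (of r') ∈ cellSpan) (hv : (seg2 a).value = r'.value) : Equivalent (seg2 a) r' := by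
  rw [Equivalent, ← mkQ_eq_mkQ_iff, ← sub_eq_zero]
  exact eq_zero_of_mem_cellSpan (sub_mem (mkQ_seg2_mem_cellSpan a ha0 ha1) hr')
    (by rw [map_sub, evalQ_mkQ, evalQ_mkQ, eval_of, eval_of, hv, sub_self])

/-- **Unconditional instance**: two rational circular segments with the same area are
equivalent under the moves. -/
theorem kz_seg2_seg2 (ha0 : 0 ≤ a) (ha1 : a < 1) {b : ℚ} (hb0 : 0 ≤ b) (hb1 : b < 1)
    (hv : (seg2 a).value = (seg2 b).value) : Equivalent (seg2 a) (seg2 b) :=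
  kz_seg2 a ha0 ha1 _ (mkQ_seg2_mem_cellSpan b hb0 hb1) hv

end SoloBlind

end Summit.KontsevichZagierPeriods.KontsevichZagierPeriods.Theorems
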